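import Literature.IUT.HodgeArakelov.RadialGraphs
import Literature.IUT.HodgeArakelov.MonoThetaProjective
import Mathlib.Algebra.Category.Grp.Basic

/-!
# [IUTchII] Corollary 1.10 — sub-DAG statements (D-0068 (1), statements-first): the functor `ℛ → ℱ`
# "arising from a functorial algorithm in the topological group `Π`"

S. Mochizuki, *Inter-universal Teichmüller theory II*, §1, Corollary 1.10 "(Multiradial Mono-theta Cyclotomic
Rigidity Isomorphisms)", kurims manuscript (Dec. 2020) pp. 46–47 [claim: Mochizuki2012, status: disputed]
(IUTchII §1 Cor 1.10, kurims pp.46-47). Record-only typing under the claim key `Mochizuki2012` (D-0012,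
disputed); abc-iut cell, sub-DAG `plan/L6/SUBDAG-IUTchII-Cor-110.md` (holder abc-iut-w5-d145).

The typing of record (`RadialGraphs.lean`, abc-iut-L6-t1, p406616) PROVES the printed conclusion — "the resulting
natural functor `Ψ_ℛ : ℛ → ℛ†` is multiradially defined" — for EVERY functor `Ξ` out of the radial category of
the exterior-cyclotomic environment (`cor110_multiradiallyDefined`, a shape theorem), and carries the SPECIFIC
functor of the corollary,

> "the cyclotomic rigidity isomorphism `(l·Δ_Θ)(Π) ⥲ Π_μ(M^Θ_*(Π))` `(∗mono-Θ_Π)` [where we identify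
> `(l·Δ_Θ)(M^Θ_*(Π))` with `(l·Δ_Θ)(Π)` — cf. Proposition 1.4] obtained by composing the functorial algorithm
> `Π ↦ M^Θ_*(Π)` of Proposition 1.2, (i) [cf. also Proposition 1.5, (i)], with the functorial algorithm for
> constructing a cyclotomic rigidity isomorphism of Proposition 1.5, (iii). Then the data consisting of the
> topological group `Π`, the topological `Π`-modules constituted by the domain and codomain of `(∗mono-Θ_Π)`,
> and the isomorphism `(∗mono-Θ_Π)` determines a functor `ℛ → ℱ` [i.e., where `ℱ` denotes the category defined
> in the evident way so as to accommodate the data just listed] which arises from a functorial algorithm in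
> the topological group `Π`" (p. 47),

as an INTERFACE INPUT (`MonoThetaRigidityFunctor S F`: an abstract functor `Ξ : IsoClass Π^tp_{X̲̲_k} ⥤ F` with
object data `F → CyclotomePairIso`). The intermediate statements between the Prop. 1.2 (i) / 1.4 / 1.5 (iii)
OUTPUTS (`EnvOfGroup`, `EtaleThetaData`, `MonoThetaProjSystem`, `ThetaEnvData` — all built) and that input are
typed here, over the built vocabulary only (no new `Prop` facts; every `Prop` below is either a DEFINITION of a
printed notion or a PROVED bookkeeping lemma):

* `C110-S1` the category `ℱ` "defined in the evident way": morphisms of `CyclotomePairIso` data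
  (`CyclotomePairIso.Hom`: an isomorphism of topological groups with compatible isomorphisms of the two modules
  intertwining the rigidity isomorphisms), with `Hom.id`, `Hom.comp` (no `Category` instance is declared: the
  laws are the lemmas `Hom.id_comp`, `Hom.comp_id`, `Hom.comp_assoc`);
* `C110-S2` the OUTPUT of the composite functorial algorithm `Π ↦ ((l·Δ_Θ)(Π), Π_μ(M^Θ_*(Π)), (∗mono-Θ_Π))`
  as a FUNCTORIAL FAMILY over `IsoClass Π^tp_{X̲̲_k}` (`MonoThetaRigidityData`, the mono-theta analogue of
  `GaloisPairRigidityData` of Cor. 1.11): per isomorph `Π` the two `Π`-modules and the equivariant isomorphism,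
  per isomorphism `Π ⥲ Π*` the transport isomorphisms — functorial, compatible with the actions, and NATURAL for
  `(∗mono-Θ)` (the naturality square is the kernel form of "functorial algorithm in `Π`");
* `C110-S3`/`S4` the object map `pairIso` and the morphism map `mapHom` into `ℱ`, with the functor laws
  `mapHom_id`, `mapHom_comp` PROVED — i.e. the functor `ℛ → ℰ → ℱ`, `(Π, G, α) ↦ Π ↦ Ξ(Π)`;
* `C110-S5` the resulting inhabitant `toRigidityFunctor : MonoThetaRigidityFunctor S (IsoClass Π^tp_{X̲̲_k})`
  (target the graph-shaped category on the isomorphs themselves, Example 1.9 (i): "the objects of `𝒢` are pairs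
  `(E, Ξ(E))` … the morphisms … the pairs of arrows `(f, Ξ(f))`"), and `C110-S6` Cor. 1.10's conclusion FOR IT
  (`cor110_multiradiallyDefined_ofData`, an instance of the shape theorem);
* `C110-S7` Prop. 1.2 (i)'s "functorial isomorphism `Π ⥲ Π_X(M^Θ(Π))`": transport of `EnvOfGroup` along
  `Π ⥲ Π*` (`EnvOfGroup.transportAlong`, DEFINED);
* `C110-S8` the `Π_X(M^Θ_*)`-MODULE structures on the domain `(l·Δ_Θ)(M^Θ_*)` and codomain `Π_μ(M^Θ_*)` of the
  limit rigidity isomorphism of Prop. 1.5 (iii), which the interface `ThetaEnvData` does not carry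
  (`ThetaEnvData.ModuleStr`: actions PINNED to the Def. 1.1 (i) actions of the members through `intCompat` /
  the coordinates), and `C110-S9` the PROVED lemma that `(∗mono-Θ)` is then `Π_X(M^Θ_*)`-equivariant
  (`ThetaEnvData.rigidLim_equivariant`: from the mod-`M` equivariance of Def. 1.1 (ii), `CyclotomicRigidity`);
* `C110-S10` the predicate `MonoThetaRigidityData.Models`: the functorial family EXTENDS the genuine output
  `(T.D.lDeltaTheta, Sys.extCycLim, T.rigidLim)` at the isomorph `Π_X(M^Θ_*)` — the junction a discharger of
  IUTchII:Cor1.10 must establish (instance = the [EtTh] Cor. 2.19 (i) invariance of the rigidity isomorphism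
  under isomorphisms of mono-theta environments, L2 `Literature.AnabelianGeometry.EtaleTheta.RigidData.Cor219_i_splittings` (ThetaRigidity.lean), proved there
  modulo the Cor. 2.18 facts).

HONEST FRAMING: definitions and bookkeeping lemmas over the cell's own typed interfaces; nothing disputed is
asserted; no side is taken on [IUTchIII] Cor. 3.12; typed ≠ discharged. Printed proof of Cor. 1.10 (p. 47):
"The various assertions of Corollary 1.10 follow immediately from the definitions involved."
-/

namespace Literature.IUT.HodgeArakelov

open CategoryTheory

universe u

variable {S : ThetaSetting.{u}}

/-! ## C110-S1: the category `ℱ` of the data `(Π, (l·Δ_Θ)(Π), Π_μ(M^Θ_*(Π)), (∗mono-Θ_Π))` -/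

namespace CyclotomePairIso

/-- **IUTchII:Cor1.10**, sub-node C110-S1 (kurims p. 47: "`ℱ` denotes the category defined in the evident way so as
to accommodate the data just listed", i.e. "the topological group `Π`, the topological `Π`-modules constituted by
the domain and codomain of `(∗mono-Θ_Π)`, and the isomorphism `(∗mono-Θ_Π)`"): a morphism of such data is an
isomorphism of topological groups `φ : Π ⥲ Π*` together with isomorphisms of the two modules that are
`φ`-semilinear for the actions and intertwine the two rigidity isomorphisms.
[claim: Mochizuki2012, status: disputed] (IUTchII §1 Cor 1.10, kurims p.47) -/
@[ext]
structure Hom (X Y : CyclotomePairIso.{u}) : Type u where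
  /-- the isomorphism of topological groups `Π ⥲ Π*` -/
  phi : X.P ≃ₜ* Y.P
  /-- the induced isomorphism of the first modules (domains of the rigidity isomorphisms) -/
  mapA : X.A ≃* Y.A
  /-- the induced isomorphism of the second modules (codomains) -/
  mapB : X.B ≃* Y.B
  mapA_act : ∀ (x : X.P) (m : X.A), mapA (X.actA x m) = Y.actA (phi x) (mapA m)
  mapB_act : ∀ (x : X.P) (m : X.B), mapB (X.actB x m) = Y.actB (phi x) (mapB m)
  /-- compatibility with the rigidity isomorphisms -/
  iso_comm : ∀ m : X.A, Y.iso (mapA m) = mapB (X.iso m)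

/-- Identity morphism of `ℱ`. [claim: Mochizuki2012, status: disputed] (IUTchII §1 Cor 1.10, kurims p.47) -/
def Hom.id (X : CyclotomePairIso.{u}) : Hom X X where
  phi := ContinuousMulEquiv.refl X.P
  mapA := MulEquiv.refl X.A
  mapB := MulEquiv.refl X.B
  mapA_act _ _ := rfl
  mapB_act _ _ := rfl
  iso_comm _ := rfl

/-- Composition in `ℱ` (diagrammatic order). [claim: Mochizuki2012, status: disputed] (IUTchII §1 Cor 1.10, kurims p.47) -/
def Hom.comp {X Y Z : CyclotomePairIso.{u}} (f : Hom X Y) (g : Hom Y Z) : Hom X Z where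
  phi := f.phi.trans g.phi
  mapA := f.mapA.trans g.mapA
  mapB := f.mapB.trans g.mapB
  mapA_act x m := by
    change g.mapA (f.mapA (X.actA x m)) = Z.actA (g.phi (f.phi x)) (g.mapA (f.mapA m))
    rw [f.mapA_act, g.mapA_act]
  mapB_act x m := by
    change g.mapB (f.mapB (X.actB x m)) = Z.actB (g.phi (f.phi x)) (g.mapB (f.mapB m))
    rw [f.mapB_act, g.mapB_act]
  iso_comm m := by
    change Z.iso (g.mapA (f.mapA m)) = g.mapB (f.mapB (X.iso m))
    rw [g.iso_comm, f.iso_comm]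

/-- `ℱ` is a category: left identity law (PROVED). [claim: Mochizuki2012, status: disputed] (IUTchII §1 Cor 1.10, kurims p.47) -/
theorem Hom.id_comp {X Y : CyclotomePairIso.{u}} (f : Hom X Y) : (Hom.id X).comp f = f :=
  Hom.ext (ContinuousMulEquiv.ext fun _ => rfl) (MulEquiv.ext fun _ => rfl) (MulEquiv.ext fun _ => rfl)

/-- `ℱ` is a category: right identity law (PROVED). [claim: Mochizuki2012, status: disputed] (IUTchII §1 Cor 1.10, kurims p.47) -/
theorem Hom.comp_id {X Y : CyclotomePairIso.{u}} (f : Hom X Y) : f.comp (Hom.id Y) = f :=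
  Hom.ext (ContinuousMulEquiv.ext fun _ => rfl) (MulEquiv.ext fun _ => rfl) (MulEquiv.ext fun _ => rfl)

/-- `ℱ` is a category: associativity (PROVED). [claim: Mochizuki2012, status: disputed] (IUTchII §1 Cor 1.10, kurims p.47) -/
theorem Hom.comp_assoc {W X Y Z : CyclotomePairIso.{u}} (f : Hom W X) (g : Hom X Y) (h : Hom Y Z) :
    (f.comp g).comp h = f.comp (g.comp h) :=
  Hom.ext (ContinuousMulEquiv.ext fun _ => rfl) (MulEquiv.ext fun _ => rfl) (MulEquiv.ext fun _ => rfl)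

/-- Every morphism of `ℱ` is invertible (PROVED shape: `ℱ` is a groupoid, as are `ℛ`, `ℛ†`).
[claim: Mochizuki2012, status: disputed] (IUTchII §1 Cor 1.10, kurims p.47) -/
def Hom.symm {X Y : CyclotomePairIso.{u}} (f : Hom X Y) : Hom Y X where
  phi := f.phi.symm
  mapA := f.mapA.symm
  mapB := f.mapB.symm
  mapA_act y n := by
    apply f.mapA.injective
    rw [MulEquiv.apply_symm_apply, f.mapA_act, MulEquiv.apply_symm_apply, ContinuousMulEquiv.apply_symm_apply]
  mapB_act y n := by
    apply f.mapB.injective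
    rw [MulEquiv.apply_symm_apply, f.mapB_act, MulEquiv.apply_symm_apply, ContinuousMulEquiv.apply_symm_apply]
  iso_comm n := by
    apply f.mapB.injective
    rw [MulEquiv.apply_symm_apply, ← f.iso_comm, MulEquiv.apply_symm_apply]

/-- Inverse law (PROVED). [claim: Mochizuki2012, status: disputed] (IUTchII §1 Cor 1.10, kurims p.47) -/
theorem Hom.symm_comp {X Y : CyclotomePairIso.{u}} (f : Hom X Y) : f.symm.comp f = Hom.id Y :=
  Hom.ext (ContinuousMulEquiv.ext fun y => f.phi.apply_symm_apply y)
    (MulEquiv.ext fun y => f.mapA.apply_symm_apply y) (MulEquiv.ext fun y => f.mapB.apply_symm_apply y)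

/-- Inverse law (PROVED). [claim: Mochizuki2012, status: disputed] (IUTchII §1 Cor 1.10, kurims p.47) -/
theorem Hom.comp_symm {X Y : CyclotomePairIso.{u}} (f : Hom X Y) : f.comp f.symm = Hom.id X :=
  Hom.ext (ContinuousMulEquiv.ext fun x => f.phi.symm_apply_apply x)
    (MulEquiv.ext fun x => f.mapA.symm_apply_apply x) (MulEquiv.ext fun x => f.mapB.symm_apply_apply x)

end CyclotomePairIso

/-! ## C110-S2: the output of `Π ↦ ((l·Δ_Θ)(Π), Π_μ(M^Θ_*(Π)), (∗mono-Θ_Π))` as a functorial family -/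

/-- **IUTchII:Cor1.10**, sub-node C110-S2 (kurims p. 47): the OUTPUT of the composite functorial group-theoretic
algorithm `Π ↦ (∗mono-Θ_Π)` — Prop. 1.2 (i) `Π ↦ M^Θ_*(Π)`, Prop. 1.4 `(l·Δ_Θ)(M^Θ_*(Π)) = (l·Δ_Θ)(Π)`, Prop. 1.5
(iii) the cyclotomic rigidity isomorphism — typed as a FUNCTORIAL FAMILY over the groupoid `IsoClass Π^tp_{X̲̲_k}`
of isomorphs of `Π^tp_{X̲̲_k}` (the encoding of `GaloisPairRigidityData`, Cor. 1.11): for every isomorph `Π` the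
`Π`-modules `(l·Δ_Θ)(Π)` ("relative to which it is abstractly isomorphic to `Ẑ(1)`", Def. 1.1 (i)) and
`Π_μ(M^Θ_*(Π))` (the projective-limit exterior cyclotome, Prop. 1.5 (iii)) and the `Π`-equivariant isomorphism
`(∗mono-Θ_Π)`; for every isomorphism `f : Π ⥲ Π*` the transport isomorphisms of the two modules ("any isomorphism
… maps the above subquotients, respectively, to the subquotients …", [EtTh] Cor. 2.18 (i)), functorial in `f`,
`f`-semilinear, and NATURAL for `(∗mono-Θ)` — the square `(∗mono-Θ_{Π*}) ∘ (l·Δ_Θ)(f) = Π_μ(f) ∘ (∗mono-Θ_Π)`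
([EtTh] Cor. 2.19 (i): the rigidity isomorphism is compatible with isomorphisms of mono-theta environments).
[claim: Mochizuki2012, status: disputed] (IUTchII §1 Cor 1.10, kurims p.47) -/
structure MonoThetaRigidityData (S : ThetaSetting.{u}) : Type (u + 1) where
  /-- `(l·Δ_Θ)(Π)`, a commutative group (bundled) -/
  intCyc : IsoClass S.PiX → CommGrpCat.{u}
  /-- `Π_μ(M^Θ_*(Π))`, a commutative group (bundled) -/
  extCyc : IsoClass S.PiX → CommGrpCat.{u}
  /-- the natural `Π`-action on `(l·Δ_Θ)(Π)` -/
  actInt : ∀ P : IsoClass S.PiX, P.G →* MulAut (intCyc P)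
  /-- the natural `Π`-action on `Π_μ(M^Θ_*(Π))` -/
  actExt : ∀ P : IsoClass S.PiX, P.G →* MulAut (extCyc P)
  /-- `(∗mono-Θ_Π) : (l·Δ_Θ)(Π) ⥲ Π_μ(M^Θ_*(Π))` -/
  monoTheta : ∀ P : IsoClass S.PiX, intCyc P ≃* extCyc P
  /-- "isomorphism of topological `Π`-modules" -/
  monoTheta_equivariant : ∀ (P : IsoClass S.PiX) (x : P.G) (m : intCyc P),
    monoTheta P (actInt P x m) = actExt P x (monoTheta P m)
  /-- transport of `(l·Δ_Θ)(-)` along `f : Π ⥲ Π*` -/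
  mapInt : ∀ {P Q : IsoClass S.PiX}, (P ⟶ Q) → (intCyc P ≃* intCyc Q)
  mapInt_id : ∀ P : IsoClass S.PiX, mapInt (𝟙 P) = MulEquiv.refl (intCyc P)
  mapInt_comp : ∀ {P Q R : IsoClass S.PiX} (f : P ⟶ Q) (g : Q ⟶ R),
    mapInt (f ≫ g) = (mapInt f).trans (mapInt g)
  /-- transport of `Π_μ(M^Θ_*(-))` along `f : Π ⥲ Π*` -/
  mapExt : ∀ {P Q : IsoClass S.PiX}, (P ⟶ Q) → (extCyc P ≃* extCyc Q)
  mapExt_id : ∀ P : IsoClass S.PiX, mapExt (𝟙 P) = MulEquiv.refl (extCyc P)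
  mapExt_comp : ∀ {P Q R : IsoClass S.PiX} (f : P ⟶ Q) (g : Q ⟶ R),
    mapExt (f ≫ g) = (mapExt f).trans (mapExt g)
  /-- the transports are `f`-semilinear -/
  mapInt_act : ∀ {P Q : IsoClass S.PiX} (f : P ⟶ Q) (x : P.G) (m : intCyc P),
    mapInt f (actInt P x m) = actInt Q (IsoClass.homIso f x) (mapInt f m)
  mapExt_act : ∀ {P Q : IsoClass S.PiX} (f : P ⟶ Q) (x : P.G) (m : extCyc P),
    mapExt f (actExt P x m) = actExt Q (IsoClass.homIso f x) (mapExt f m)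
  /-- NATURALITY of `(∗mono-Θ)` ("functorial algorithm in the topological group `Π`") -/
  monoTheta_natural : ∀ {P Q : IsoClass S.PiX} (f : P ⟶ Q) (m : intCyc P),
    monoTheta Q (mapInt f m) = mapExt f (monoTheta P m)

namespace MonoThetaRigidityData

variable (D : MonoThetaRigidityData S)

/-! ## C110-S3/S4: the functor `ℛ → ℰ → ℱ`, `(Π, G, α) ↦ Π ↦ (Π, (l·Δ_Θ)(Π), Π_μ(M^Θ_*(Π)), (∗mono-Θ_Π))` -/

/-- **IUTchII:Cor1.10**, sub-node C110-S3 (kurims p. 47: "the data consisting of the topological group `Π`, the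
topological `Π`-modules constituted by the domain and codomain of `(∗mono-Θ_Π)`, and the isomorphism
`(∗mono-Θ_Π)`"): the object map `Π ↦ Ξ(Π) ∈ ℱ`, valued in abc-iut-L6-t1's `CyclotomePairIso` (DEFINED).
[claim: Mochizuki2012, status: disputed] (IUTchII §1 Cor 1.10, kurims p.47) -/
def pairIso (P : IsoClass S.PiX) : CyclotomePairIso.{u} where
  P := P.G
  A := D.intCyc P
  B := D.extCyc P
  actA := D.actInt P
  actB := D.actExt P
  iso := D.monoTheta P
  equivariant := D.monoTheta_equivariant P

/-- The underlying topological group of `Ξ(Π)` is `Π` (definitionally).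
[claim: Mochizuki2012, status: disputed] (IUTchII §1 Cor 1.10, kurims p.47) -/
theorem pairIso_P (P : IsoClass S.PiX) : (D.pairIso P).P = P.G := rfl

/-- **IUTchII:Cor1.10**, sub-node C110-S4: the morphism map `(f : Π ⥲ Π*) ↦ Ξ(f) : Ξ(Π) → Ξ(Π*)` in `ℱ`
(DEFINED from the transport isomorphisms). [claim: Mochizuki2012, status: disputed] (IUTchII §1 Cor 1.10, kurims p.47) -/
def mapHom {P Q : IsoClass S.PiX} (f : P ⟶ Q) : (D.pairIso P).Hom (D.pairIso Q) where
  phi := IsoClass.homIso f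
  mapA := D.mapInt f
  mapB := D.mapExt f
  mapA_act := D.mapInt_act f
  mapB_act := D.mapExt_act f
  iso_comm := D.monoTheta_natural f

/-- Functor law `Ξ(𝟙_Π) = 𝟙` (PROVED). [claim: Mochizuki2012, status: disputed] (IUTchII §1 Cor 1.10, kurims p.47) -/
theorem mapHom_id (P : IsoClass S.PiX) : D.mapHom (𝟙 P) = CyclotomePairIso.Hom.id (D.pairIso P) :=
  CyclotomePairIso.Hom.ext (ContinuousMulEquiv.ext fun _ => rfl)
    (by change D.mapInt (𝟙 P) = MulEquiv.refl _; exact D.mapInt_id P)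
    (by change D.mapExt (𝟙 P) = MulEquiv.refl _; exact D.mapExt_id P)

/-- Functor law `Ξ(f ≫ g) = Ξ(f) ≫ Ξ(g)` (PROVED). [claim: Mochizuki2012, status: disputed] (IUTchII §1 Cor 1.10, kurims p.47) -/
theorem mapHom_comp {P Q R : IsoClass S.PiX} (f : P ⟶ Q) (g : Q ⟶ R) :
    D.mapHom (f ≫ g) = (D.mapHom f).comp (D.mapHom g) :=
  CyclotomePairIso.Hom.ext (ContinuousMulEquiv.ext fun _ => rfl)
    (by change D.mapInt (f ≫ g) = (D.mapInt f).trans (D.mapInt g); exact D.mapInt_comp f g)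
    (by change D.mapExt (f ≫ g) = (D.mapExt f).trans (D.mapExt g); exact D.mapExt_comp f g)

/-! ## C110-S5/S6: the functor of Corollary 1.10 in the typing of record, and the conclusion for it -/

/-- **IUTchII:Cor1.10**, sub-node C110-S5: the functor `ℛ → ℱ` "which arises from a functorial algorithm in the
topological group `Π`" as an inhabitant of abc-iut-L6-t1's interface `MonoThetaRigidityFunctor` — with target the
graph-shaped category on the isomorphs of `Π^tp_{X̲̲_k}` themselves (Example 1.9 (i): the graph of a functorial
algorithm `Ξ` on `IsoClass Π` has objects `(Π, Ξ(Π))` and morphisms `(f, Ξ(f))`, i.e. it is `IsoClass Π` with the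
object data `Ξ(Π)` attached; the morphism data `Ξ(f)` are `mapHom`, with the functor laws `mapHom_id`,
`mapHom_comp`). [claim: Mochizuki2012, status: disputed] (IUTchII §1 Cor 1.10, kurims p.47) -/
def toRigidityFunctor : MonoThetaRigidityFunctor S (IsoClass S.PiX) where
  Ξ := 𝟭 (IsoClass S.PiX)
  data := D.pairIso
  data_P _ := rfl

/-- **IUTchII:Cor1.10**, sub-node C110-S6 (kurims p. 47: "In particular, the resulting natural functor
`Ψ_ℛ : ℛ → ℛ†` [cf. Example 1.9, (i)] is multiradially defined"), for the functor determined by the family `D`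
over the exterior-cyclotomic environment of Example 1.8 (v), (vi) (shape `ex18iii S Γ^{×μ}`): an INSTANCE of the
shape theorem `cor110_multiradiallyDefined` (PROVED). [claim: Mochizuki2012, status: disputed] (IUTchII §1 Cor 1.10, kurims p.47) -/
theorem cor110_multiradiallyDefined_ofData (Γxμ : Type u) [Group Γxμ] :
    ((ex18iii S Γxμ).toDagger
      (CategoryTheory.Prod.fst _ _ ⋙ D.toRigidityFunctor.Ξ)).IsMultiradiallyDefined :=
  cor110_multiradiallyDefined S Γxμ D.toRigidityFunctor

/-- The daggered environment `(ℛ†, 𝒞, Φ†)` of Corollary 1.10 for the functor determined by `D` (= t1's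
`cor110Dagger` at `toRigidityFunctor`). [claim: Mochizuki2012, status: disputed] (IUTchII §1 Cor 1.10, kurims p.47) -/
def dagger (Γxμ : Type u) [Group Γxμ] : RadialEnvironment.{u, u + 1} :=
  cor110Dagger S Γxμ D.toRigidityFunctor

end MonoThetaRigidityData

/-! ## C110-S7: Proposition 1.2 (i)'s "functorial isomorphism `Π ⥲ Π_X(M^Θ(Π))`" along `Π ⥲ Π*` -/

/-- **IUTchII:Cor1.10**, sub-node C110-S7 (input Prop. 1.2 (i), kurims p. 25: "the composite … admits a functorial
isomorphism `Π ⥲ Π_X(M^Θ(Π))`"): the Prop. 1.2 (i) output is transported along an isomorphism of topological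
groups `e : Π ⥲ Π*` — same mono-theta environment `M^Θ(Π*) := M^Θ(Π)`, same Def. 1.1 (i) output, and
`Π* ⥲ Π ⥲ Π_X(M^Θ(Π))` (DEFINED; this is the functoriality in `Π` the printed word "functorial" asserts, in the
OUTPUT encoding of `MonoThetaFromGroups`). [claim: Mochizuki2012, status: disputed] (IUTchII §1 Prop 1.2 (i), kurims p.25) -/
def EnvOfGroup.transportAlong {P P' : TopGroup.{u}} (E : EnvOfGroup S P) (e : P ≃ₜ* P') : EnvOfGroup S P' where
  isoRef := ⟨e.symm.trans E.isoRef.some⟩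
  env := E.env
  recon := E.recon
  isoX := e.symm.trans E.isoX

/-- The transported functorial isomorphism is `isoX ∘ e⁻¹` (definitional check).
[claim: Mochizuki2012, status: disputed] (IUTchII §1 Prop 1.2 (i), kurims p.25) -/
theorem EnvOfGroup.transportAlong_isoX_apply {P P' : TopGroup.{u}} (E : EnvOfGroup S P) (e : P ≃ₜ* P')
    (x : P') : (E.transportAlong e).isoX x = E.isoX (e.symm x) := rfl

/-! ## C110-S8/S9: the module structures on the two sides of `(∗mono-Θ)` at `Π = Π_X(M^Θ_*)` -/

namespace ThetaEnvData

variable {F : ModelFamily S} {Sys : MonoThetaProjSystem F} (T : ThetaEnvData Sys)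

/-- **IUTchII:Cor1.10**, sub-node C110-S8 (kurims p. 47: "the topological `Π`-modules constituted by the domain and
codomain of `(∗mono-Θ_Π)`"; Def. 1.1 (i) p. 21: "`(l·Δ_Θ)(M)` … admits a natural `Π_X(M)`-action", "`Π_μ(M)` …
admits a natural `Π_X(M)`-action"): the `Π_X(M^Θ_*)`-module structures on the domain `(l·Δ_Θ)(M^Θ_*)` (Prop. 1.4
output `T.D.lDeltaTheta`) and the codomain `Π_μ(M^Θ_*)` (`Sys.extCycLim`, Prop. 1.5 (iii)) of the limit rigidity
isomorphism `T.rigidLim` — NOT carried by the interface `ThetaEnvData` — PINNED to the Def. 1.1 (i) actions of the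
members `M^Θ_M`: on `Π_μ(M^Θ_*) ⊆ ∏_M Π_{M^Θ_M}` coordinatewise through `Reconstruction.extAct`, on `(l·Δ_Θ)(M^Θ_*)`
through the identifications `T.intCompat M` with `(l·Δ_Θ)(M^Θ_M) ⊗ ℤ/Mℤ` and `Reconstruction.intAct` (both along
`Sys.toPiX M : Π_X(M^Θ_M) → Π_X(M^Θ_*)`, the identification of Prop. 1.5 (ii)).
[claim: Mochizuki2012, status: disputed] (IUTchII §1 Cor 1.10, kurims p.47) -/
structure ModuleStr (T : ThetaEnvData Sys) : Type u where
  /-- the `Π_X(M^Θ_*)`-action on `(l·Δ_Θ)(M^Θ_*) = (l·Δ_Θ)(Π_X(M^Θ_*))` -/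
  actInt : Sys.PiX →* MulAut T.D.lDeltaTheta.carrier
  /-- the `Π_X(M^Θ_*)`-action on `Π_μ(M^Θ_*)` -/
  actExt : Sys.PiX →* MulAut Sys.extCycLim
  /-- coordinatewise it is the Def. 1.1 (i) action on `Π_μ(M^Θ_M)` -/
  actExt_level : ∀ (M : ℕ+) (xM : (Sys.recon M).PiX) (y : Sys.extCycLim),
    ((actExt (Sys.toPiX M xM) y : Sys.extCycLim) : ∀ M', (Sys.env M').Pi) M =
      (((Sys.recon M).extAct xM ⟨(y : ∀ M', (Sys.env M').Pi) M, y.2.1 M⟩ : (Sys.recon M).extCyc) :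
        (Sys.env M).Pi)
  /-- through `intCompat M` it is the Def. 1.1 (i) action on `(l·Δ_Θ)(M^Θ_M) ⊗ ℤ/Mℤ` -/
  actInt_level : ∀ (M : ℕ+) (xM : (Sys.recon M).PiX) (a : T.D.lDeltaTheta.carrier)
    (c : (Sys.recon M).intCyc.carrier), T.intCompat M a = QuotientGroup.mk c →
      T.intCompat M (actInt (Sys.toPiX M xM) a) = QuotientGroup.mk ((Sys.recon M).intAct xM c)

/-- **IUTchII:Cor1.10**, sub-node C110-S9 (kurims p. 47: `(∗mono-Θ_Π)` is an isomorphism of topological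
`Π`-MODULES), PROVED at `Π = Π_X(M^Θ_*)`: for module structures pinned as in `ModuleStr`, the limit rigidity
isomorphism `(l·Δ_Θ)(M^Θ_*) ⥲ Π_μ(M^Θ_*)` of Prop. 1.5 (iii) is `Π_X(M^Θ_*)`-equivariant, by the mod-`M`
equivariance of the Def. 1.1 (ii) isomorphisms (`CyclotomicRigidity.equivariant`) and `rigidLim_compat`, for
elements of `Π_X(M^Θ_*)` that come from every `Π_X(M^Θ_M)` (all of them, once the transition maps are
isomorphisms — Prop. 1.5 (ii), `transitionsAreIsos`). [claim: Mochizuki2012, status: disputed] (IUTchII §1 Cor 1.10, kurims p.47) -/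
theorem rigidLim_equivariant (A : T.ModuleStr) (x : Sys.PiX)
    (hx : ∀ M : ℕ+, ∃ xM : (Sys.recon M).PiX, Sys.toPiX M xM = x) (a : T.D.lDeltaTheta.carrier) :
    T.rigidLim (A.actInt x a) = A.actExt x (T.rigidLim a) := by
  apply Subtype.ext
  funext M
  obtain ⟨xM, rfl⟩ := hx M
  obtain ⟨c, hc⟩ := QuotientGroup.mk_surjective (T.intCompat M a)
  have h1 : T.intCompat M (A.actInt (Sys.toPiX M xM) a) =
      QuotientGroup.mk ((Sys.recon M).intAct xM c) :=
    A.actInt_level M xM a c hc.symm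
  have h2 : (⟨((T.rigidLim a : Sys.extCycLim) : ∀ M', (Sys.env M').Pi) M, (T.rigidLim a).2.1 M⟩ :
      (Sys.recon M).extCyc) = (T.rigid M).iso (QuotientGroup.mk c) := by
    apply Subtype.ext
    change ((T.rigidLim a : Sys.extCycLim) : ∀ M', (Sys.env M').Pi) M = _
    rw [T.rigidLim_compat M a, ← hc]
    rfl
  rw [T.rigidLim_compat M, h1, A.actExt_level M xM, h2, ← (T.rigid M).equivariant xM c]
  rfl

/-- If every transition `Π_X(M^Θ_M) → Π_X(M^Θ_*)` is surjective (Prop. 1.5 (ii): they are isomorphisms), the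
limit rigidity isomorphism is equivariant for ALL of `Π_X(M^Θ_*)` (PROVED).
[claim: Mochizuki2012, status: disputed] (IUTchII §1 Cor 1.10, kurims p.47) -/
theorem rigidLim_equivariant_of_surjective (A : T.ModuleStr)
    (hsurj : ∀ M : ℕ+, Function.Surjective (Sys.toPiX M)) (x : Sys.PiX) (a : T.D.lDeltaTheta.carrier) :
    T.rigidLim (A.actInt x a) = A.actExt x (T.rigidLim a) :=
  T.rigidLim_equivariant A x (fun M => hsurj M x) a

end ThetaEnvData

/-! ## C110-S10: the junction "the functorial family extends the genuine output at `Π_X(M^Θ_*)`" -/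

/-- **IUTchII:Cor1.10**, sub-node C110-S10: the functorial family `D` MODELS the genuine outputs of Props. 1.2 (i) /
1.4 / 1.5 (iii) — at the isomorph `Π_X(M^Θ_*)` of `Π^tp_{X̲̲_k}` (an object of `IsoClass Π^tp_{X̲̲_k}` by the Prop. 1.4
datum `T.D.isoRef`) its value is isomorphic, equivariantly and compatibly with `(∗mono-Θ)`, to
`((l·Δ_Θ)(M^Θ_*), Π_μ(M^Θ_*), T.rigidLim)` with the pinned module structures `A`. This is the junction a discharger
of IUTchII:Cor1.10 establishes (together with an inhabitant `D`): the instance is [EtTh] Cor. 2.19 (i) — the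
cyclotomic rigidity isomorphism of a mono-theta environment is preserved by all isomorphisms of mono-theta
environments (L2: `Literature.AnabelianGeometry.EtaleTheta.RigidData.Cor219_i_splittings`, ThetaRigidity.lean, proved there modulo the Cor. 2.18 facts) — which
makes the transported outputs (`Def11Output.transport`) a NATURAL family. PREDICATE (definition of the junction,
not a fact). [claim: Mochizuki2012, status: disputed] (IUTchII §1 Cor 1.10, kurims p.47) -/
def MonoThetaRigidityData.Models (D : MonoThetaRigidityData S) {F : ModelFamily S}
    {Sys : MonoThetaProjSystem F} (T : ThetaEnvData Sys) (A : T.ModuleStr) : Prop :=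
  ∃ (a : D.intCyc ⟨Sys.PiX, T.D.isoRef⟩ ≃* T.D.lDeltaTheta.carrier)
    (b : D.extCyc ⟨Sys.PiX, T.D.isoRef⟩ ≃* Sys.extCycLim),
    (∀ (x : Sys.PiX) (m : D.intCyc ⟨Sys.PiX, T.D.isoRef⟩),
        a (D.actInt ⟨Sys.PiX, T.D.isoRef⟩ x m) = A.actInt x (a m)) ∧
    (∀ (x : Sys.PiX) (m : D.extCyc ⟨Sys.PiX, T.D.isoRef⟩),
        b (D.actExt ⟨Sys.PiX, T.D.isoRef⟩ x m) = A.actExt x (b m)) ∧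
    ∀ m : D.intCyc ⟨Sys.PiX, T.D.isoRef⟩, T.rigidLim (a m) = b (D.monoTheta ⟨Sys.PiX, T.D.isoRef⟩ m)

end Literature.IUT.HodgeArakelov
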